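import Summits.AtomisticToContinuum.Crystallization.Theorems.GappedShellCensusCleanLimitsHaveWindowsBoxPinningC
import Summits.AtomisticToContinuum.Crystallization.Theorems.GappedShellCensusCleanLimitsHaveWindowsMeanInplaneStress
import Summits.AtomisticToContinuum.Crystallization.Theorems.GappedShellCensusCleanLimitsHaveWindowsInplaneGain
import Summits.AtomisticToContinuum.Crystallization.Theorems.GappedShellCensusCleanLimitsHaveWindowsVerticalPinning

/-!
# `GappedShellCensus.CleanLimitsHaveWindows` (stmt-AtomisticToContinuum-15932), line `Sketch`: ZERO-STRESS BOX PINNING,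
# composed (T4)

An exactly layered, everywhere-clean hull element `Z = v + A(S(a′, s, z))` of a Lennard-Jones ground-state sequence with
rooted-uniformly recurrent point set yields a layered hull element with parameters in the box of stmt-11779
(`a″ ∈ [47/50, 1]`, increments in `[39a″/50, 17a″/20]`): geometric bounds (`stub_geometricBounds`, landed …BoxPinningC),
in-plane pinning E1 to the window `(191/200, 99/100)` (`inplanePinning`, from the landed `stub_meanInplaneStress` and the
certified `stub_inplaneGain`), and vertical/menu pinning (`stub_verticalPinning`, landed). Anchor: `boxPinning`. [folklore]
-/

noncomputable section

namespace Summit.AtomisticToContinuum.Crystallization.Theorems.CleanHull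

open scoped BigOperators
open Filter Metric
open Literature.MathematicalPhysics.StatisticalMechanics
open Literature.Geometry.DiscreteGeometry

/-- Heights on `ℤ` with prescribed increments exist (normalised by `z 0 = 0`). [folklore] -/
theorem exists_heights (Δ : ℤ → ℝ) : ∃ z : ℤ → ℝ, ∀ m : ℤ, z (m + 1) - z m = Δ m := by
  refine ⟨fun m => if 0 ≤ m then ∑ k ∈ Finset.range m.toNat, Δ k
    else -∑ k ∈ Finset.range (-m).toNat, Δ (-(k : ℤ) - 1), fun m => ?_⟩
  rcases lt_trichotomy m (-1) with hm | rfl | hm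
  · have h1 : ¬ (0 ≤ m + 1) := by omega
    have h2 : ¬ (0 ≤ m) := by omega
    simp only [if_neg h1, if_neg h2]
    have e : (-m).toNat = (-(m + 1)).toNat + 1 := by omega
    rw [e, Finset.sum_range_succ]
    have e2 : (-(((-(m + 1)).toNat : ℕ) : ℤ) - 1) = m := by omega
    rw [e2]; ring
  · norm_num
  · have h1 : 0 ≤ m + 1 := by omega
    have h2 : 0 ≤ m := by omega
    simp only [if_pos h1, if_pos h2]
    have e : (m + 1).toNat = m.toNat + 1 := by omega
    rw [e, Finset.sum_range_succ]
    have e2 : ((m.toNat : ℕ) : ℤ) = m := by omega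
    rw [e2]; ring

/-- **E1 (in-plane pinning, composed from T4b-ii and T4b-iii).** An exactly layered clean hull element has in-plane spacing
in the window `(191/200, 99/100)`: on either sliver the in-plane rescaled competitor with preserved interlayer bonds gains `≥ c` per
layer (`stub_inplaneGain`) while the window sums of the gains are bounded (`stub_meanInplaneStress`) — `bp_noUniformGain`.
[folklore] -/
theorem inplanePinning (x : (N : ℕ) → (Fin N → EuclideanSpace ℝ (Fin 3)))
    (hx : ∀ N, IsGroundState lennardJones (x N)) (a a' : ℝ) (ha : 47 / 50 ≤ a) (ha1 : a ≤ 1) (ha' : 0 < a')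
    (A : EuclideanSpace ℝ (Fin 3) →ₗᵢ[ℝ] EuclideanSpace ℝ (Fin 3)) (s : ℤ → ℤ) (z : ℤ → ℝ)
    (v : EuclideanSpace ℝ (Fin 3)) (hs : IsHaggSeq s) (hz : ∀ m : ℤ, 0 < z (m + 1) - z m)
    (Z : Set (EuclideanSpace ℝ (Fin 3)))
    (hZ : Z = (fun p => p + v) '' {p : EuclideanSpace ℝ (Fin 3) | ∃ m i j : ℤ,
        p = A (((i : ℝ) • triangularVec₁ a') + ((j : ℝ) • triangularVec₂ a') +
          ((haggLabel s m : ℝ) • barlowOffset a') + (z m • layerNormal 1))})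
    (hH : ∀ R ε : ℝ, 0 < ε → ∃ᶠ N in Filter.atTop, ∃ t : EuclideanSpace ℝ (Fin 3),
        (∀ p ∈ Z, ‖p‖ ≤ R → ∃ i : Fin N, dist (x N i + t) p ≤ ε) ∧
        (∀ i : Fin N, ‖x N i + t‖ ≤ R → ∃ p ∈ Z, dist (x N i + t) p ≤ ε))
    (hgeo : a * (1 - 1 / 50) ≤ a' ∧ a' ≤ a * (1 + 1 / 50) ∧
      ∀ m : ℤ, (a * (1 - 1 / 50)) ^ 2 ≤ a' ^ 2 / 3 + (z (m + 1) - z m) ^ 2 ∧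
        a' ^ 2 / 3 + (z (m + 1) - z m) ^ 2 ≤ (a * (1 + 1 / 50)) ^ 2) :
    191 / 200 < a' ∧ a' < 99 / 100 := by
  obtain ⟨C, hC⟩ := stub_meanInplaneStress
  obtain ⟨c, hc, hgain⟩ := stub_inplaneGain
  obtain ⟨hlo, hhi, hband⟩ := hgeo
  -- the untranslated set is in the hull
  set S : Set (EuclideanSpace ℝ (Fin 3)) := {p : EuclideanSpace ℝ (Fin 3) | ∃ m i j : ℤ,
      p = A (((i : ℝ) • triangularVec₁ a') + ((j : ℝ) • triangularVec₂ a') +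
        ((haggLabel s m : ℝ) • barlowOffset a') + (z m • layerNormal 1))} with hS
  have hHS : ∀ R ε : ℝ, 0 < ε → ∃ᶠ N in Filter.atTop, ∃ t : EuclideanSpace ℝ (Fin 3),
      (∀ p ∈ S, ‖p‖ ≤ R → ∃ i : Fin N, dist (x N i + t) p ≤ ε) ∧
      (∀ i : Fin N, ‖x N i + t‖ ≤ R → ∃ p ∈ S, dist (x N i + t) p ≤ ε) := by
    refine LayeredHull.rec_hull_translate x v hH ?_ ?_
    · intro p hp; rw [hZ]; exact ⟨p, hp, rfl⟩
    · intro q hq; rw [hZ] at hq; obtain ⟨p, hp, rfl⟩ := hq; simpa using hp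
  -- increments are at least `3a'/4`, interlayer bonds in `[9/10, 51/50]`
  have ha0 : 0 < a := by linarith
  have hincr : ∀ m : ℤ, 3 / 4 * a' ≤ z (m + 1) - z m := by
    intro m
    have h1 := (hband m).1
    have hzp := hz m
    nlinarith [hzp, h1, hlo, hhi, ha0]
  have hbond : ∀ m : ℤ, (9 / 10 : ℝ) ^ 2 ≤ a' ^ 2 / 3 + (z (m + 1) - z m) ^ 2 ∧
      a' ^ 2 / 3 + (z (m + 1) - z m) ^ 2 ≤ (51 / 50 : ℝ) ^ 2 := by
    intro m
    obtain ⟨h1, h2⟩ := hband m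
    constructor
    · nlinarith [h1, ha, ha0]
    · nlinarith [h2, ha1, ha0]
  -- the competitor heights for a given `lam`
  have hcomp : ∀ lam : ℝ, 99 / 100 ≤ lam → lam ≤ 101 / 100 →
      ∃ z' : ℤ → ℝ, (∀ m : ℤ, (z' (m + 1) - z' m) ^ 2 = (z (m + 1) - z m) ^ 2 + a' ^ 2 * (1 - lam ^ 2) / 3) ∧
        (∀ m : ℤ, 0 < z' (m + 1) - z' m) := by
    intro lam hl1 hl2
    have hpos : ∀ m : ℤ, 0 < (z (m + 1) - z m) ^ 2 + a' ^ 2 * (1 - lam ^ 2) / 3 := by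
      intro m
      have h34 := hincr m
      have hΔsq : (3 / 4 * a') ^ 2 ≤ (z (m + 1) - z m) ^ 2 :=
        pow_le_pow_left₀ (by positivity) h34 2
      have hlam2 : lam ^ 2 ≤ (101 / 100) ^ 2 := pow_le_pow_left₀ (by linarith) hl2 2
      have ha2 : 0 < a' ^ 2 := by positivity
      nlinarith [hΔsq, hlam2, ha2]
    obtain ⟨z', hz'⟩ := exists_heights fun m => Real.sqrt ((z (m + 1) - z m) ^ 2 + a' ^ 2 * (1 - lam ^ 2) / 3)
    refine ⟨z', ?_, ?_⟩
    · intro m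
      rw [hz', Real.sq_sqrt (hpos m).le]
    · intro m
      rw [hz']
      exact Real.sqrt_pos.2 (hpos m)
  constructor
  · -- lower sliver: a' ≤ 191/200 is impossible
    by_contra hle
    push Not at hle
    obtain ⟨z', hz'1, hz'2⟩ := hcomp (201 / 200) (by norm_num) (by norm_num)
    have hlow : 23 / 25 ≤ a' := by nlinarith [hlo, ha]
    refine bp_noUniformGain hc (fun m => hgain s hs a' z z' (201 / 200) (Or.inr ⟨hlow, hle, rfl⟩) hbond hz hz'1 hz'2 m)
      (fun m₁ n => hC x hx a' hlow (by linarith) A s z hincr hHS (201 / 200) (by norm_num) (by norm_num) z' hz'1 hz'2 m₁ n)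
  · -- upper sliver: 99/100 ≤ a' is impossible
    by_contra hle
    push Not at hle
    obtain ⟨z', hz'1, hz'2⟩ := hcomp (199 / 200) (by norm_num) (by norm_num)
    have hup : a' ≤ 51 / 50 := by nlinarith [hhi, ha1]
    have hlow : 23 / 25 ≤ a' := by linarith
    refine bp_noUniformGain hc (fun m => hgain s hs a' z z' (199 / 200) (Or.inl ⟨hle, hup, rfl⟩) hbond hz hz'1 hz'2 m)
      (fun m₁ n => hC x hx a' hlow hup A s z hincr hHS (199 / 200) (by norm_num) (by norm_num) z' hz'1 hz'2 m₁ n)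

/-- **Zero-stress pinning (T4b, composed from E1 and T4b-iv).** [folklore] -/
theorem zeroStressPinning (x : (N : ℕ) → (Fin N → EuclideanSpace ℝ (Fin 3)))
    (hx : ∀ N, IsGroundState lennardJones (x N)) (a a' : ℝ) (ha : 47 / 50 ≤ a) (ha1 : a ≤ 1) (ha' : 0 < a')
    (A : EuclideanSpace ℝ (Fin 3) →ₗᵢ[ℝ] EuclideanSpace ℝ (Fin 3)) (s : ℤ → ℤ) (z : ℤ → ℝ)
    (v : EuclideanSpace ℝ (Fin 3)) (hs : IsHaggSeq s) (hz : ∀ m : ℤ, 0 < z (m + 1) - z m)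
    (Z : Set (EuclideanSpace ℝ (Fin 3)))
    (hZ : Z = (fun p => p + v) '' {p : EuclideanSpace ℝ (Fin 3) | ∃ m i j : ℤ,
        p = A (((i : ℝ) • triangularVec₁ a') + ((j : ℝ) • triangularVec₂ a') +
          ((haggLabel s m : ℝ) • barlowOffset a') + (z m • layerNormal 1))})
    (hclean : ∀ y ∈ Z, ({w ∈ Z | w ≠ y ∧ dist y w ≤ a * (1 + 1 / 50)}.ncard = 12 ∧
        ∀ w ∈ Z, w ≠ y → a * (1 - 1 / 50) ≤ dist y w ∧
          (dist y w ≤ a * (1 + 1 / 50) ∨ a * (63 / 50) ≤ dist y w)) ∧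
      ∃ T : Finset (EuclideanSpace ℝ (Fin 3)), (↑T : Set (EuclideanSpace ℝ (Fin 3))) =
          (fun w => a⁻¹ • (w - y)) '' {w ∈ Z | w ≠ y ∧ dist y w ≤ a * (1 + 1 / 50)} ∧
        (ShellCloseTo (1 / 5) T fccKissingPattern ∨ ShellCloseTo (1 / 5) T hcpKissingPattern))
    (hH : ∀ R ε : ℝ, 0 < ε → ∃ᶠ N in Filter.atTop, ∃ t : EuclideanSpace ℝ (Fin 3),
        (∀ p ∈ Z, ‖p‖ ≤ R → ∃ i : Fin N, dist (x N i + t) p ≤ ε) ∧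
        (∀ i : Fin N, ‖x N i + t‖ ≤ R → ∃ p ∈ Z, dist (x N i + t) p ≤ ε))
    (hrec : ∀ R ε : ℝ, 0 < ε → ∃ G : ℝ, ∀ w ∈ Z, ∃ g ∈ Z, dist g w ≤ G ∧
      BallMatch ε R 0 ((fun p => p - g) '' Z) Z)
    (hgeo : a * (1 - 1 / 50) ≤ a' ∧ a' ≤ a * (1 + 1 / 50) ∧
      ∀ m : ℤ, (a * (1 - 1 / 50)) ^ 2 ≤ a' ^ 2 / 3 + (z (m + 1) - z m) ^ 2 ∧
        a' ^ 2 / 3 + (z (m + 1) - z m) ^ 2 ≤ (a * (1 + 1 / 50)) ^ 2) :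
    ∃ (a'' : ℝ) (A' : EuclideanSpace ℝ (Fin 3) →ₗᵢ[ℝ] EuclideanSpace ℝ (Fin 3)) (s' : ℤ → ℤ) (z' : ℤ → ℝ),
      47 / 50 ≤ a'' ∧ a'' ≤ 1 ∧ IsHaggSeq s' ∧
      (∀ m : ℤ, 39 / 50 * a'' ≤ z' (m + 1) - z' m ∧ z' (m + 1) - z' m ≤ 17 / 20 * a'') ∧
      ∀ R ε : ℝ, 0 < ε → ∃ᶠ N in Filter.atTop, ∃ t : EuclideanSpace ℝ (Fin 3),
        (∀ p ∈ {p : EuclideanSpace ℝ (Fin 3) | ∃ m i j : ℤ, p = A' (((i : ℝ) • triangularVec₁ a'') +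
            ((j : ℝ) • triangularVec₂ a'') + ((haggLabel s' m : ℝ) • barlowOffset a'') + (z' m • layerNormal 1))},
          ‖p‖ ≤ R → ∃ i : Fin N, dist (x N i + t) p ≤ ε) ∧
        (∀ i : Fin N, ‖x N i + t‖ ≤ R → ∃ p ∈ {p : EuclideanSpace ℝ (Fin 3) | ∃ m i j : ℤ,
            p = A' (((i : ℝ) • triangularVec₁ a'') + ((j : ℝ) • triangularVec₂ a'') +
              ((haggLabel s' m : ℝ) • barlowOffset a'') + (z' m • layerNormal 1))},
          dist (x N i + t) p ≤ ε) :=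
  stub_verticalPinning x hx a a' ha ha1 ha' A s z v hs hz Z hZ hclean hH hrec hgeo
    (inplanePinning x hx a a' ha ha1 ha' A s z v hs hz Z hZ hH hgeo)

/-- **Box pinning (T4, composed from T4a and T4b).** [folklore] -/
theorem boxPinning (x : (N : ℕ) → (Fin N → EuclideanSpace ℝ (Fin 3)))
    (hx : ∀ N, IsGroundState lennardJones (x N)) (a a' : ℝ) (ha : 47 / 50 ≤ a) (ha1 : a ≤ 1) (ha' : 0 < a')
    (A : EuclideanSpace ℝ (Fin 3) →ₗᵢ[ℝ] EuclideanSpace ℝ (Fin 3)) (s : ℤ → ℤ) (z : ℤ → ℝ)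
    (v : EuclideanSpace ℝ (Fin 3)) (hs : IsHaggSeq s) (hz : ∀ m : ℤ, 0 < z (m + 1) - z m)
    (Z : Set (EuclideanSpace ℝ (Fin 3)))
    (hZ : Z = (fun p => p + v) '' {p : EuclideanSpace ℝ (Fin 3) | ∃ m i j : ℤ,
        p = A (((i : ℝ) • triangularVec₁ a') + ((j : ℝ) • triangularVec₂ a') +
          ((haggLabel s m : ℝ) • barlowOffset a') + (z m • layerNormal 1))})
    (hclean : ∀ y ∈ Z, ({w ∈ Z | w ≠ y ∧ dist y w ≤ a * (1 + 1 / 50)}.ncard = 12 ∧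
        ∀ w ∈ Z, w ≠ y → a * (1 - 1 / 50) ≤ dist y w ∧
          (dist y w ≤ a * (1 + 1 / 50) ∨ a * (63 / 50) ≤ dist y w)) ∧
      ∃ T : Finset (EuclideanSpace ℝ (Fin 3)), (↑T : Set (EuclideanSpace ℝ (Fin 3))) =
          (fun w => a⁻¹ • (w - y)) '' {w ∈ Z | w ≠ y ∧ dist y w ≤ a * (1 + 1 / 50)} ∧
        (ShellCloseTo (1 / 5) T fccKissingPattern ∨ ShellCloseTo (1 / 5) T hcpKissingPattern))
    (hH : ∀ R ε : ℝ, 0 < ε → ∃ᶠ N in Filter.atTop, ∃ t : EuclideanSpace ℝ (Fin 3),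
        (∀ p ∈ Z, ‖p‖ ≤ R → ∃ i : Fin N, dist (x N i + t) p ≤ ε) ∧
        (∀ i : Fin N, ‖x N i + t‖ ≤ R → ∃ p ∈ Z, dist (x N i + t) p ≤ ε))
    (hrec : ∀ R ε : ℝ, 0 < ε → ∃ G : ℝ, ∀ w ∈ Z, ∃ g ∈ Z, dist g w ≤ G ∧
      BallMatch ε R 0 ((fun p => p - g) '' Z) Z) :
    ∃ (a'' : ℝ) (A' : EuclideanSpace ℝ (Fin 3) →ₗᵢ[ℝ] EuclideanSpace ℝ (Fin 3)) (s' : ℤ → ℤ) (z' : ℤ → ℝ),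
      47 / 50 ≤ a'' ∧ a'' ≤ 1 ∧ IsHaggSeq s' ∧
      (∀ m : ℤ, 39 / 50 * a'' ≤ z' (m + 1) - z' m ∧ z' (m + 1) - z' m ≤ 17 / 20 * a'') ∧
      ∀ R ε : ℝ, 0 < ε → ∃ᶠ N in Filter.atTop, ∃ t : EuclideanSpace ℝ (Fin 3),
        (∀ p ∈ {p : EuclideanSpace ℝ (Fin 3) | ∃ m i j : ℤ, p = A' (((i : ℝ) • triangularVec₁ a'') +
            ((j : ℝ) • triangularVec₂ a'') + ((haggLabel s' m : ℝ) • barlowOffset a'') + (z' m • layerNormal 1))},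
          ‖p‖ ≤ R → ∃ i : Fin N, dist (x N i + t) p ≤ ε) ∧
        (∀ i : Fin N, ‖x N i + t‖ ≤ R → ∃ p ∈ {p : EuclideanSpace ℝ (Fin 3) | ∃ m i j : ℤ,
            p = A' (((i : ℝ) • triangularVec₁ a'') + ((j : ℝ) • triangularVec₂ a'') +
              ((haggLabel s' m : ℝ) • barlowOffset a'') + (z' m • layerNormal 1))},
          dist (x N i + t) p ≤ ε) :=
  zeroStressPinning x hx a a' ha ha1 ha' A s z v hs hz Z hZ hclean hH hrec
    (stub_geometricBounds a a' ha ha' A s z v hs hz Z hZ hclean)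

end Summit.AtomisticToContinuum.Crystallization.Theorems.CleanHull

end
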